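import Summits.QuantumFields.BalabanUV.Beta.FP.CubicGermWard
import Summits.QuantumFields.BalabanUV.Beta.FP.QuadGermUniqueness

/-!
# `BalabanUV.Beta.FP.CubicGermExchange` — road «FP» for binder row D1, sub-row H2-G-ANTI13-KER of row H2-G (owner b2b-balaban-beta-d1-p3):
# `Anti13 (cubicGermOf S)` ⟺ THE KERNEL'S BOSE EXCHANGE DEFECT (background leg ↔ a fluctuation leg) HAS NO FIRST MOMENTS, for a localised translation-covariant
# cubic stencil family; ASSEMBLY: THE CUBIC GERM IS `cQ·ymGerm` FROM KERNEL-LEVEL LETTERS ALONE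

HONEST DEPENDENCY (page 1, mandatory): continuum YM on T⁴ ⇐ BetaPertH ∧ nine spine estimates (0/9 proved); BetaPertH ⇐ (D1) ∧ (D4) ∧ CAP+tail;
G-an2-4 gates asym, D1 and NE2/3/4.  HONEST FRAMING (cell contract, verbatim): «discharging `BetaPertH` makes Bałaban's UV stability UNCONDITIONAL —
a real constructive-QFT result; it is NOT the continuum limit and NOT the Clay problem.»  THIS MODULE DISCHARGES NOTHING of the wall: `ℓ¹` re-indexing on `ℤ⁴ × ℤ⁴`
([folklore]; `FP/CubicGermPairing`, `FP/CubicGermWard`, `FP/QuadGermUniqueness`, `FP/MarginalUniquenessWardMinimal` BY NAME); 0 def, no cite, no `def … : Prop`, 0 sorry.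
It verifies the defect condition for NO effective or perfect stencil (H2-V ∕ the slot rows' business), nor for an2's level-0 `wilsonA` (whose germ-level `Anti13` is `WilsonCubicGerm.symmetries_wilsonA`).  NOT H2-G proper, NOT hasym, NOT D1, NOT BetaPertH, NOT
continuum, NOT Clay.

ABSOLUTE RULE (cell charter, verbatim): «No internally-minted statement may enter as a cited fact. Every hypothesis is either kernel-proved in this package or a
verbatim quotation of a PUBLISHED theorem with page reference. The manuscript(s) under audit are NOT citable for their own disputed steps — they are the thing
under adjudication; programme-internal (2001/route/tribunal) claims are never citable.»

WHAT IS PROVED.  For `S : Fin 4 → ℤ⁴ → MKer 4 (Fib 3)` with `LocStencil S Cs δ` (`δ > 0`) and translation covariance (`S λ v = shiftK (−v) (S λ 0)`), put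
`D_{λμν}(x,z) := S μ 0 x z (inl λ) (inl ν) + S λ x 0 z (inl μ) (inl ν)` — the EXCHANGE DEFECT of the kernel under background leg `(0, λ)` ↔ first fluctuation leg
`(x, μ)` (the colour factor `f^{abc}` being stripped, Bose SYMMETRY of the full vertex is ANTISYMMETRY of the table — `MarginalUniqueness`'s encoding; the defect is
written inline, no definition):
* §1 `biLoc_exchange` ∕ `summable_exchange` ∕ `tsum_exchange_eq_pairOf` (the exchanged member `(x,z) ↦ S λ x 0 z` is `BiLoc` at `(0,0)` at half rate and pairs, after the
  involution `(x,z) ↦ (−x, z−x)` of `ℤ⁴ × ℤ⁴`, as the straight member against the reflected weight); `cubicGermOf_exchange_fst`: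
  `cubicGermOf S λ ν μ κ 0 = cubicGermOf S μ ν λ κ 0 + ∑' D·x_κ`; `cubicGermOf_exchange_snd`: `cubicGermOf S λ ν μ κ 1 = cubicGermOf S μ ν λ κ 0 − cubicGermOf S μ ν λ κ 1 + ∑' D·z_κ`;
  **`anti13_iff_defect : Anti13 (cubicGermOf S) ↔ (∀ ∑' D·x_κ = 0) ∧ (∀ ∑' D·z_κ = 0)`** — germ-level Bose antisymmetry 1 ↔ 3 IS the vanishing of the defect's two first
  moments (the defect itself, a higher-order-in-momentum object such as the commutator terms of a `U_φ·U_B` parametrisation, need not vanish); corollary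
  `anti13_cubicGermOf_of_exchange` (exact antisymmetry `S λ u x z (inl μ)(inl ν) = −S μ x u z (inl λ)(inl ν)` ⟹ `Anti13`).
* §2 ASSEMBLY **`cubicGermOf_eq_ymGerm_of_letters`**: (h1) `LocStencil`, (h2) translation covariance, (h3) the divergence law at `0` with `(c, M)`
  (`CubicGermWard`), (h4) `Decays M CM δM`, (h5) first column moment of `M` zero, (h6) the two first moments of the exchange defect vanish, (h7) hyperoctahedral
  covariance of `M`'s column (`QuadGermUniqueness`) ⟹ `cubicGermOf S μ ν λ κ i = cQ · ymGerm μ ν λ κ i` with `cQ = −(c/2)·∑'_x M x 0 (inl 0) (inl 0)·x₁²` EXPLICIT, together with the two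
  moment identities `α = 0`, `γ = 0` that Ward forces on `M` — «the cubic germ of a localised, covariant, gauge-invariant, Bose-antisymmetric stencil family IS the
  Yang–Mills germ, normalised by the Hessian's transverse second moment», from kernel-level letters only.
THE H2-G CHECKLIST (owner d1-p3, journal l.22605 — the seven letters of `cubicGermOf_eq_ymGerm_of_letters`, and what supplies them for the PERFECT stencil
`S_∞` of row H2-G proper; this module proves NONE of them for `S_∞`):
  (h1) `LocStencil S Cs δ`, `δ > 0` — uniform localisation of the cubic jet (the slot rows' `UniformDecay`-type letters);
  (h2) `∀ λ v, S λ v = shiftK (−v) (S λ 0)` — translation covariance by the unit (coarse) lattice;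
  (h3) `∀ x z μ ν, divV S 0 x z (inl μ) (inl ν) = c · M x z (inl μ) (inl ν) · ([z = 0] − [x = 0])` — the divergence (Ward) law = gauge invariance of the
       action at cubic order, `M` the Hessian's field–field block (`CubicGermWard.law_of_conjV` from an2's commutator form);
  (h4) `Decays M CM δM`, `δM > 0` — localisation of the Hessian block (`CubicGermWard.col_row_of_decays`);
  (h5) `∀ μ ν κ, ∑'_x M x 0 (inl μ) (inl ν) · x_κ = 0` — no first moment of the Hessian column (⟺ zeroth moment of `S` zero, `CubicGermWard.tsum_zeroth_eq_col`);
       for the BOND form (v1.1) also `∀ μ ν, ∑'_x M x 0 (inl μ) (inl ν) = 0` — `M` annihilates constant 1-forms (zero-momentum gauge invariance, `W166lim_zero`-type);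
       IN `latticeKernel` CURRENCY (owner l.22894): for a column `x ↦ M x 0 (inl μ)(inl ν)` that is the (real part of the) lattice kernel of a strip-regular symbol
       `p ↦ M̂_{μν}(p)`, the two letters read `M̂_{μν}(0) = 0` (zeroth moment) and `∂_κ M̂_{μν}(0) = 0` (first moments) — the symbol VANISHES TO SECOND ORDER at `p = 0`
       (Fourier series at `p = 0` and its gradient; the supplier's lemma, not proved here);
  (h6) `∀ μ ν λ κ, ∑'_{(x,z)} D_{λμν}(x,z) · x_κ = 0` and `… · z_κ = 0`, `D_{λμν}(x,z) = S μ 0 x z (inl λ)(inl ν) + S λ x 0 z (inl μ)(inl ν)` — the exchange defect has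
       no first moments (background-field symmetry of the third jet AT GERM LEVEL; `anti13_iff_defect`);
  (h7) `M (x ∘ σ⁻¹) 0 (inl σμ) (inl σν) = M x 0 (inl μ) (inl ν)` and the BOND reflection law `M (r_α x + t_{αμν}·e_α) 0 (inl μ) (inl ν) = rs α μ · rs α ν ·
       M x 0 (inl μ) (inl ν)` with an integer shift table `t` (v1.1, `QuadGermUniqueness.quadMomentOf_eq_quadGerm_bond`; `t = [ν=α] − [μ=α]` for an2's `bref`, since a
       reflection re-bases `α`-bonds) — hyperoctahedral covariance of the Hessian column (the `PerfectSymbolPerm` ∕ `W166Inf_cflip` lineage on the perfect side).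
       [v1's `cubicGermOf_eq_ymGerm_of_letters` used the UNSHIFTED (0-form) reflection letter `t = 0` — true as stated but NOT the law of a 1-form Hessian off the
       diagonal; the consumer-facing assembly is v1.1's `cubicGermOf_eq_ymGerm_of_bondLetters`.]
  OUTPUT: `cubicGermOf S = cQ · ymGerm`, `cQ = c · (−½ ∑'_x M x 0 (inl 0) (inl 0) · x₁²)`, plus the two transversality identities `α = 0`, `γ = 0` on `M`'s second
  moments; `CubicGermFunctional.tendsto_cubicGermOf` then carries `germ = cQ_k · ymGerm` along the step ∕ blocking limits.
v1.1 (same seat — OWN LOCATED CORRECTION of letter (h7)): + `cubicGermOf_eq_ymGerm_of_bondLetters` (bond reflection law with shift table + zeroth column moment).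
Provenance: G-an2-4 formalisation swarm seat b2b-balaban-gan24-formalise-leaf-02 gen 37 (cross-lane on road FP), 2026-08-20.
-/

noncomputable section

namespace Summit.QuantumFields.BalabanUV.Beta.FP.CubicGermExchange

open Finset
open scoped BigOperators
open Literature.MathematicalPhysics.QuantumFieldTheory.Balaban1983to89
open Literature.MathematicalPhysics.QuantumFieldTheory.Balaban1983to89.Beta
open Literature.MathematicalPhysics.QuantumFieldTheory.Balaban1983to89.B12Sec2to5 (l1)
open Literature.MathematicalPhysics.QuantumFieldTheory.Balaban1983to89.Beta.ExpKernelCalculus (Site MKer Decays shiftK)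
open Literature.MathematicalPhysics.QuantumFieldTheory.Balaban1983to89.Beta.OneStepResolventKernel (Fib LocStencil)
open Literature.MathematicalPhysics.QuantumFieldTheory.Balaban1983to89.Beta.KernelWard (divV)
open Summit.QuantumFields.BalabanUV.Beta.FP.MarginalUniqueness (Idx ymGerm Anti13 rs)
open Summit.QuantumFields.BalabanUV.Beta.FP.WardNormalisation (quadGerm)
open Summit.QuantumFields.BalabanUV.Beta.FP.WilsonCubicGerm (cubicGermOf)
open Summit.QuantumFields.BalabanUV.Beta.FP.CubicGermPairing
open Summit.QuantumFields.BalabanUV.Beta.FP.CubicGermWard (cubicGermOf_eq_of_law_anti13 col_row_of_decays tsum_zeroth_eq_zero_of_col)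
open Summit.QuantumFields.BalabanUV.Beta.FP.QuadGermUniqueness (quadMomentOf_eq_quadGerm quadMomentOf_eq_quadGerm_bond)

/-! ## §1 The exchange defect of the kernel and `Anti13` of the germ -/

section Exchange

variable {S : Fin 4 → Site 4 → MKer 4 (Fib 3)} {Cs δ : ℝ}

/-- [folklore] the re-indexing `(x, z) ↦ (−x, z − x)` (move the background site to the first leg's site and reflect) is an involution of `ℤ⁴ × ℤ⁴`. -/
theorem involutive_exchange : Function.Involutive fun xz : Site 4 × Site 4 => (-xz.1, xz.2 - xz.1) := by
  intro xz
  ext <;> simp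

/-- [folklore] THE EXCHANGED MEMBER IS BI-LOCALISED AT `(0,0)` (half rate): `(x,z) ↦ S λ x 0 z` — background leg at the first site, first leg at the origin —
satisfies `BiLoc … 0 0 Cs (δ/2)` (`LocStencil` localises `S λ x` at `(x, x)`; `|x|₁ + |z − x|₁ ≥ ½(|x|₁ + |z|₁)`). -/
theorem biLoc_exchange (hS : LocStencil S Cs δ) (hδ : 0 < δ) (lam : Fin 4) :
    ExpKernelCalculus.BiLoc (fun x z a b => S lam x 0 z a b) 0 0 Cs (δ / 2) := by
  intro x z a b
  have h := hS lam x 0 z a b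
  have hC : 0 ≤ Cs := (hS lam 0).nonneg a
  have t := ExpKernelCalculus.l1_sub_triangle z x 0
  have hx := B12Sec2to5.l1_nonneg (x - 0)
  have hzx := B12Sec2to5.l1_nonneg (z - x)
  rw [ExpKernelCalculus.l1_sub_symm (0 : Site 4) x] at h
  show |S lam x 0 z a b| ≤ Cs * Real.exp (-(δ / 2) * (l1 (x - 0) + l1 (z - 0)))
  refine h.trans (mul_le_mul_of_nonneg_left (Real.exp_le_exp.mpr ?_) hC)
  nlinarith

/-- [folklore] summability of the exchanged member against a polynomial weight. -/
theorem summable_exchange (hS : LocStencil S Cs δ) (hδ : 0 < δ) {φ : Site 4 → Site 4 → ℝ} {A : ℝ} {k : ℕ} (hA : 0 ≤ A) (hφ : ∀ x z, |φ x z| ≤ A * ((l1 x + 1) ^ k * (l1 z + 1) ^ k)) (lam μ ν : Fin 4) :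
    Summable fun xz : Site 4 × Site 4 => S lam xz.1 0 xz.2 (Sum.inl μ) (Sum.inl ν) * φ xz.1 xz.2 :=
  CubicGermFunctional.summable_prod_of_biLoc (biLoc_jointWeight (biLoc_exchange hS hδ lam) (half_pos hδ) hA hφ) (half_pos (half_pos hδ))
    (Sum.inl μ) (Sum.inl ν)

/-- [folklore] the exchanged member pairs, after the involution, as the straight member against the reflected weight:
`∑'_{(x,z)} S λ x 0 z · φ(x,z) = ∑'_{(x,z)} S λ 0 x z · φ(−x, z − x)`. -/
theorem tsum_exchange_eq_pairOf (hcov : ∀ (lam : Fin 4) (v : Site 4), S lam v = shiftK (-v) (S lam 0)) (lam μ ν : Fin 4) (φ : Site 4 → Site 4 → ℝ) :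
    ∑' xz : Site 4 × Site 4, S lam xz.1 0 xz.2 (Sum.inl μ) (Sum.inl ν) * φ xz.1 xz.2 = pairOf S lam μ ν (fun x z => φ (-x) (z - x)) := by
  unfold pairOf
  rw [← (involutive_exchange.toPerm _).tsum_eq (fun xz : Site 4 × Site 4 => S lam 0 xz.1 xz.2 (Sum.inl μ) (Sum.inl ν) * φ (-xz.1) (xz.2 - xz.1))]
  refine tsum_congr fun xz => ?_
  rw [hcov lam xz.1]
  simp only [Function.Involutive.coe_toPerm, shiftK, ← sub_eq_add_neg, zero_sub, neg_neg, sub_neg_eq_add, sub_add_cancel]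

/-- [folklore] **THE `p`-PART UNDER EXCHANGE, WITH DEFECT**: `cubicGermOf S λ ν μ κ 0 = cubicGermOf S μ ν λ κ 0 + ∑'_{(x,z)} D_{λμν}(x,z)·x_κ`, where
`D_{λμν}(x,z) := S μ 0 x z (inl λ) (inl ν) + S λ x 0 z (inl μ) (inl ν)` is the EXCHANGE DEFECT of the kernel (background leg ↔ first fluctuation leg). -/
theorem cubicGermOf_exchange_fst (hS : LocStencil S Cs δ) (hδ : 0 < δ) (hcov : ∀ (lam : Fin 4) (v : Site 4), S lam v = shiftK (-v) (S lam 0))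
    (μ ν lam κ : Fin 4) :
    cubicGermOf S lam ν μ κ 0 = cubicGermOf S μ ν lam κ 0 +
      ∑' xz : Site 4 × Site 4, (S μ 0 xz.1 xz.2 (Sum.inl lam) (Sum.inl ν) + S lam xz.1 0 xz.2 (Sum.inl μ) (Sum.inl ν)) * (xz.1 κ : ℝ) := by
  have h1 := summable_pairOf hS hδ zero_le_one (abs_fst_le_weight κ) μ lam ν
  have h2 := summable_exchange hS hδ zero_le_one (abs_fst_le_weight κ) lam μ ν
  have e2 : ∑' xz : Site 4 × Site 4, S lam xz.1 0 xz.2 (Sum.inl μ) (Sum.inl ν) * (xz.1 κ : ℝ) = -cubicGermOf S μ ν lam κ 0 := by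
    rw [tsum_exchange_eq_pairOf hcov lam μ ν (fun x _ => (x κ : ℝ)), ← pairOf_fst, ← neg_one_mul (pairOf S lam μ ν _), ← pairOf_smul]
    exact pairOf_congr S lam μ ν fun x z => by simp only [Pi.neg_apply, Int.cast_neg, neg_one_mul]
  rw [← pairOf_fst S μ lam ν κ]
  unfold pairOf
  simp only [add_mul]
  rw [h1.tsum_add h2, e2]
  ring

/-- [folklore] **THE `q`-PART UNDER EXCHANGE, WITH DEFECT**: `cubicGermOf S λ ν μ κ 1 = cubicGermOf S μ ν λ κ 0 − cubicGermOf S μ ν λ κ 1 + ∑'_{(x,z)} D_{λμν}(x,z)·z_κ`. -/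
theorem cubicGermOf_exchange_snd (hS : LocStencil S Cs δ) (hδ : 0 < δ) (hcov : ∀ (lam : Fin 4) (v : Site 4), S lam v = shiftK (-v) (S lam 0))
    (μ ν lam κ : Fin 4) :
    cubicGermOf S lam ν μ κ 1 = cubicGermOf S μ ν lam κ 0 - cubicGermOf S μ ν lam κ 1 +
      ∑' xz : Site 4 × Site 4, (S μ 0 xz.1 xz.2 (Sum.inl lam) (Sum.inl ν) + S lam xz.1 0 xz.2 (Sum.inl μ) (Sum.inl ν)) * (xz.2 κ : ℝ) := by
  have h1 := summable_pairOf hS hδ zero_le_one (abs_snd_le_weight κ) μ lam ν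
  have h2 := summable_exchange hS hδ zero_le_one (abs_snd_le_weight κ) lam μ ν
  have e2 : ∑' xz : Site 4 × Site 4, S lam xz.1 0 xz.2 (Sum.inl μ) (Sum.inl ν) * (xz.2 κ : ℝ) =
      cubicGermOf S μ ν lam κ 1 - cubicGermOf S μ ν lam κ 0 := by
    rw [tsum_exchange_eq_pairOf hcov lam μ ν (fun _ z => (z κ : ℝ)), ← pairOf_fst, ← pairOf_snd]
    unfold pairOf
    rw [← (summable_pairOf hS hδ zero_le_one (abs_snd_le_weight κ) lam μ ν).tsum_sub
      (summable_pairOf hS hδ zero_le_one (abs_fst_le_weight κ) lam μ ν)]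
    refine tsum_congr fun xz => ?_
    simp only [Pi.sub_apply, Int.cast_sub]
    ring
  rw [← pairOf_snd S μ lam ν κ]
  unfold pairOf
  simp only [add_mul]
  rw [h1.tsum_add h2, e2]
  ring

/-- [our object] **`Anti13` OF THE GERM ⟺ THE EXCHANGE DEFECT HAS NO FIRST MOMENTS.**  For a localised, translation-covariant stencil family the germ-level Bose
antisymmetry `Anti13 (cubicGermOf S)` (legs 1 ↔ 3 of `FP/MarginalUniqueness`) holds IF AND ONLY IF both first moments of the kernel's exchange defect
`D_{λμν}(x,z) = S μ 0 x z (inl λ)(inl ν) + S λ x 0 z (inl μ)(inl ν)` vanish — the defect itself (a higher-order-in-momentum object, e.g. the commutator terms of a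
`U_φ·U_B` parametrisation) need NOT vanish. -/
theorem anti13_iff_defect (hS : LocStencil S Cs δ) (hδ : 0 < δ) (hcov : ∀ (lam : Fin 4) (v : Site 4), S lam v = shiftK (-v) (S lam 0)) :
    Anti13 (cubicGermOf S) ↔
      (∀ μ ν lam κ : Fin 4, ∑' xz : Site 4 × Site 4, (S μ 0 xz.1 xz.2 (Sum.inl lam) (Sum.inl ν) + S lam xz.1 0 xz.2 (Sum.inl μ) (Sum.inl ν)) * (xz.1 κ : ℝ) = 0) ∧
      (∀ μ ν lam κ : Fin 4, ∑' xz : Site 4 × Site 4, (S μ 0 xz.1 xz.2 (Sum.inl lam) (Sum.inl ν) + S lam xz.1 0 xz.2 (Sum.inl μ) (Sum.inl ν)) * (xz.2 κ : ℝ) = 0) := by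
  constructor
  · rintro ⟨h0, h1⟩
    have A : ∀ μ ν lam κ : Fin 4,
        ∑' xz : Site 4 × Site 4, (S μ 0 xz.1 xz.2 (Sum.inl lam) (Sum.inl ν) + S lam xz.1 0 xz.2 (Sum.inl μ) (Sum.inl ν)) * (xz.1 κ : ℝ) = 0 := by
      intro μ ν lam κ
      have e := cubicGermOf_exchange_fst hS hδ hcov μ ν lam κ
      have a := h0 μ ν lam κ
      linarith
    refine ⟨A, fun μ ν lam κ => ?_⟩
    have e := cubicGermOf_exchange_snd hS hδ hcov μ ν lam κ
    have e' := cubicGermOf_exchange_fst hS hδ hcov μ ν lam κ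
    have a := h1 μ ν lam κ
    have b := A μ ν lam κ
    linarith
  · rintro ⟨hA, hB⟩
    refine ⟨fun μ ν lam κ => ?_, fun μ ν lam κ => ?_⟩
    · rw [cubicGermOf_exchange_fst hS hδ hcov, hA, add_zero]
    · rw [cubicGermOf_exchange_snd hS hδ hcov, cubicGermOf_exchange_fst hS hδ hcov, hA, hB]
      ring

/-- [our object] COROLLARY: **EXACT KERNEL-LEVEL EXCHANGE ANTISYMMETRY** `S λ u x z (inl μ) (inl ν) = −S μ x u z (inl λ) (inl ν)` (defect zero) ⟹ `Anti13 (cubicGermOf S)`. -/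
theorem anti13_cubicGermOf_of_exchange (hS : LocStencil S Cs δ) (hδ : 0 < δ) (hcov : ∀ (lam : Fin 4) (v : Site 4), S lam v = shiftK (-v) (S lam 0))
    (hX : ∀ (lam μ ν : Fin 4) (u x z : Site 4), S lam u x z (Sum.inl μ) (Sum.inl ν) = -S μ x u z (Sum.inl lam) (Sum.inl ν)) :
    Anti13 (cubicGermOf S) := by
  refine (anti13_iff_defect hS hδ hcov).2 ⟨fun μ ν lam κ => ?_, fun μ ν lam κ => ?_⟩ <;>
  · simp only [hX μ lam ν 0, neg_add_cancel, zero_mul, tsum_zero]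

end Exchange

/-! ## §2 Assembly: the cubic germ is `cQ·ymGerm` from kernel-level letters alone -/

section Assembly

variable {S : Fin 4 → Site 4 → MKer 4 (Fib 3)} {Cs δ c CM δM : ℝ} {M : MKer 4 (Fib 3)}

/-- [our object] **THE CUBIC GERM OF A LOCALISED, COVARIANT, GAUGE-INVARIANT, BOSE-ANTISYMMETRIC STENCIL FAMILY IS THE YANG–MILLS GERM, NORMALISED BY THE
HESSIAN'S TRANSVERSE SECOND MOMENT.**  Hypotheses, all kernel-level: (h1) `LocStencil S Cs δ`, `δ > 0`; (h2) translation covariance; (h3) the divergence law at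
the background site `0` with constant `c` and Hessian block `M`; (h4) `Decays M CM δM`, `δM > 0`; (h5) the first column moment of `M` vanishes; (h6) the exchange
defect of the kernel has no first moments (`anti13_iff_defect`; exact antisymmetry is the special case); (h7) hyperoctahedral covariance of `M`'s column through `0`.  Conclusion: `cubicGermOf S = cQ · ymGerm` with
`cQ = −(c/2)·∑'_x M x 0 (inl 0) (inl 0)·x₁²`, and Ward's transversality constraints `α = 0`, `γ = 0` on the second moments of `M`
(`CubicGermWard.cubicGermOf_eq_of_law_anti13` + `QuadGermUniqueness.quadMomentOf_eq_quadGerm` + `anti13_cubicGermOf_of_exchange`). -/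
theorem cubicGermOf_eq_ymGerm_of_letters (hS : LocStencil S Cs δ) (hδ : 0 < δ)
    (hcov : ∀ (lam : Fin 4) (v : Site 4), S lam v = shiftK (-v) (S lam 0))
    (hlaw : ∀ (x z : Site 4) (μ ν : Fin 4), divV S 0 x z (Sum.inl μ) (Sum.inl ν) =
      c * M x z (Sum.inl μ) (Sum.inl ν) * ((if z = 0 then (1 : ℝ) else 0) - (if x = 0 then (1 : ℝ) else 0)))
    (hM : Decays M CM δM) (hδM : 0 < δM)
    (hM1 : ∀ (μ ν κ : Fin 4), ∑' x : Site 4, M x 0 (Sum.inl μ) (Sum.inl ν) * (x κ : ℝ) = 0)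
    (hD0 : ∀ μ ν lam κ : Fin 4,
      ∑' xz : Site 4 × Site 4, (S μ 0 xz.1 xz.2 (Sum.inl lam) (Sum.inl ν) + S lam xz.1 0 xz.2 (Sum.inl μ) (Sum.inl ν)) * (xz.1 κ : ℝ) = 0)
    (hD1 : ∀ μ ν lam κ : Fin 4,
      ∑' xz : Site 4 × Site 4, (S μ 0 xz.1 xz.2 (Sum.inl lam) (Sum.inl ν) + S lam xz.1 0 xz.2 (Sum.inl μ) (Sum.inl ν)) * (xz.2 κ : ℝ) = 0)
    (hP : ∀ (σ : Equiv.Perm Idx) (x : Site 4) (μ ν : Fin 4),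
      M (fun i => x (σ.symm i)) 0 (Sum.inl (σ μ)) (Sum.inl (σ ν)) = M x 0 (Sum.inl μ) (Sum.inl ν))
    (hF : ∀ (α : Idx) (x : Site 4) (μ ν : Fin 4),
      M (fun i => if i = α then -x i else x i) 0 (Sum.inl μ) (Sum.inl ν) = rs α μ * rs α ν * M x 0 (Sum.inl μ) (Sum.inl ν)) :
    (∀ μ ν lam κ i, cubicGermOf S μ ν lam κ i =
        (c * (-(1 / 2 : ℝ) * ∑' x : Site 4, M x 0 (Sum.inl 0) (Sum.inl 0) * ((x 1 : ℝ) * (x 1 : ℝ)))) * ymGerm μ ν lam κ i) ∧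
      c * ((-(1 / 2 : ℝ) * ∑' x : Site 4, M x 0 (Sum.inl 0) (Sum.inl 1) * ((x 0 : ℝ) * (x 1 : ℝ))) +
          (-(1 / 2 : ℝ) * ∑' x : Site 4, M x 0 (Sum.inl 0) (Sum.inl 1) * ((x 1 : ℝ) * (x 0 : ℝ))) +
          (-(1 / 2 : ℝ) * ∑' x : Site 4, M x 0 (Sum.inl 0) (Sum.inl 0) * ((x 1 : ℝ) * (x 1 : ℝ)))) = 0 ∧
      c * ((-(1 / 2 : ℝ) * ∑' x : Site 4, M x 0 (Sum.inl 0) (Sum.inl 0) * ((x 0 : ℝ) * (x 0 : ℝ))) -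
          (-(1 / 2 : ℝ) * ∑' x : Site 4, M x 0 (Sum.inl 0) (Sum.inl 0) * ((x 1 : ℝ) * (x 1 : ℝ))) -
          (-(1 / 2 : ℝ) * ∑' x : Site 4, M x 0 (Sum.inl 0) (Sum.inl 1) * ((x 0 : ℝ) * (x 1 : ℝ))) -
          (-(1 / 2 : ℝ) * ∑' x : Site 4, M x 0 (Sum.inl 0) (Sum.inl 1) * ((x 1 : ℝ) * (x 0 : ℝ)))) = 0 := by
  have hcr := col_row_of_decays (M := M) hM
  have hZ := tsum_zeroth_eq_zero_of_col hS hδ hcov hlaw hcr.1 hcr.2 hδM hM1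
  have h13 := (anti13_iff_defect hS hδ hcov).2 ⟨hD0, hD1⟩
  have hQ : ∀ k μ ν, c * quadMomentOf M k μ ν =
      quadGerm (c * (-(1 / 2 : ℝ) * ∑' x : Site 4, M x 0 (Sum.inl 0) (Sum.inl 0) * ((x 1 : ℝ) * (x 1 : ℝ))))
        (c * ((-(1 / 2 : ℝ) * ∑' x : Site 4, M x 0 (Sum.inl 0) (Sum.inl 1) * ((x 0 : ℝ) * (x 1 : ℝ))) +
          (-(1 / 2 : ℝ) * ∑' x : Site 4, M x 0 (Sum.inl 0) (Sum.inl 1) * ((x 1 : ℝ) * (x 0 : ℝ))) +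
          (-(1 / 2 : ℝ) * ∑' x : Site 4, M x 0 (Sum.inl 0) (Sum.inl 0) * ((x 1 : ℝ) * (x 1 : ℝ)))))
        (c * ((-(1 / 2 : ℝ) * ∑' x : Site 4, M x 0 (Sum.inl 0) (Sum.inl 0) * ((x 0 : ℝ) * (x 0 : ℝ))) -
          (-(1 / 2 : ℝ) * ∑' x : Site 4, M x 0 (Sum.inl 0) (Sum.inl 0) * ((x 1 : ℝ) * (x 1 : ℝ))) -
          (-(1 / 2 : ℝ) * ∑' x : Site 4, M x 0 (Sum.inl 0) (Sum.inl 1) * ((x 0 : ℝ) * (x 1 : ℝ))) -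
          (-(1 / 2 : ℝ) * ∑' x : Site 4, M x 0 (Sum.inl 0) (Sum.inl 1) * ((x 1 : ℝ) * (x 0 : ℝ))))) k μ ν := by
    intro k μ ν
    rw [quadMomentOf_eq_quadGerm hcr.1 hδM hP hF k μ ν]
    unfold quadGerm
    ring
  exact cubicGermOf_eq_of_law_anti13 hS hδ hcov hlaw hcr.1 hcr.2 hδM hZ hQ h13

/-- [our object] (v1.1) **THE ASSEMBLY UNDER THE BOND LAWS** — the consumer-facing form for LATTICE GAUGE-FIELD (1-form) Hessians: as
`cubicGermOf_eq_ymGerm_of_letters`, but (h5) asks the ZEROTH as well as the first column moments of `M` to vanish (`M` annihilates constant 1-forms — the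
zero-momentum gauge invariance of the quadratic form, `W166lim_zero`-type) and (h7) is the BOND reflection law with an integer shift table `t`
(`QuadGermUniqueness.quadMomentOf_eq_quadGerm_bond`; `t = [ν=α] − [μ=α]` for an2's `bref`).  Same conclusion: `cubicGermOf S = cQ · ymGerm`,
`cQ = c·(−½ ∑'_x M x 0 (inl 0) (inl 0)·x₁²)`, and `α = γ = 0`. -/
theorem cubicGermOf_eq_ymGerm_of_bondLetters (hS : LocStencil S Cs δ) (hδ : 0 < δ)
    (hcov : ∀ (lam : Fin 4) (v : Site 4), S lam v = shiftK (-v) (S lam 0))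
    (hlaw : ∀ (x z : Site 4) (μ ν : Fin 4), divV S 0 x z (Sum.inl μ) (Sum.inl ν) =
      c * M x z (Sum.inl μ) (Sum.inl ν) * ((if z = 0 then (1 : ℝ) else 0) - (if x = 0 then (1 : ℝ) else 0)))
    (hM : Decays M CM δM) (hδM : 0 < δM)
    (hM0 : ∀ (μ ν : Fin 4), ∑' x : Site 4, M x 0 (Sum.inl μ) (Sum.inl ν) = 0)
    (hM1 : ∀ (μ ν κ : Fin 4), ∑' x : Site 4, M x 0 (Sum.inl μ) (Sum.inl ν) * (x κ : ℝ) = 0)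
    (hD0 : ∀ μ ν lam κ : Fin 4,
      ∑' xz : Site 4 × Site 4, (S μ 0 xz.1 xz.2 (Sum.inl lam) (Sum.inl ν) + S lam xz.1 0 xz.2 (Sum.inl μ) (Sum.inl ν)) * (xz.1 κ : ℝ) = 0)
    (hD1 : ∀ μ ν lam κ : Fin 4,
      ∑' xz : Site 4 × Site 4, (S μ 0 xz.1 xz.2 (Sum.inl lam) (Sum.inl ν) + S lam xz.1 0 xz.2 (Sum.inl μ) (Sum.inl ν)) * (xz.2 κ : ℝ) = 0)
    (hP : ∀ (σ : Equiv.Perm Idx) (x : Site 4) (μ ν : Fin 4),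
      M (fun i => x (σ.symm i)) 0 (Sum.inl (σ μ)) (Sum.inl (σ ν)) = M x 0 (Sum.inl μ) (Sum.inl ν))
    (t : Idx → Idx → Idx → ℤ)
    (hF : ∀ (α : Idx) (x : Site 4) (μ ν : Fin 4),
      M (fun i => if i = α then -x i + t α μ ν else x i) 0 (Sum.inl μ) (Sum.inl ν) = rs α μ * rs α ν * M x 0 (Sum.inl μ) (Sum.inl ν)) :
    (∀ μ ν lam κ i, cubicGermOf S μ ν lam κ i =
        (c * (-(1 / 2 : ℝ) * ∑' x : Site 4, M x 0 (Sum.inl 0) (Sum.inl 0) * ((x 1 : ℝ) * (x 1 : ℝ)))) * ymGerm μ ν lam κ i) ∧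
      c * ((-(1 / 2 : ℝ) * ∑' x : Site 4, M x 0 (Sum.inl 0) (Sum.inl 1) * ((x 0 : ℝ) * (x 1 : ℝ))) +
          (-(1 / 2 : ℝ) * ∑' x : Site 4, M x 0 (Sum.inl 0) (Sum.inl 1) * ((x 1 : ℝ) * (x 0 : ℝ))) +
          (-(1 / 2 : ℝ) * ∑' x : Site 4, M x 0 (Sum.inl 0) (Sum.inl 0) * ((x 1 : ℝ) * (x 1 : ℝ)))) = 0 ∧
      c * ((-(1 / 2 : ℝ) * ∑' x : Site 4, M x 0 (Sum.inl 0) (Sum.inl 0) * ((x 0 : ℝ) * (x 0 : ℝ))) -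
          (-(1 / 2 : ℝ) * ∑' x : Site 4, M x 0 (Sum.inl 0) (Sum.inl 0) * ((x 1 : ℝ) * (x 1 : ℝ))) -
          (-(1 / 2 : ℝ) * ∑' x : Site 4, M x 0 (Sum.inl 0) (Sum.inl 1) * ((x 0 : ℝ) * (x 1 : ℝ))) -
          (-(1 / 2 : ℝ) * ∑' x : Site 4, M x 0 (Sum.inl 0) (Sum.inl 1) * ((x 1 : ℝ) * (x 0 : ℝ)))) = 0 := by
  have hcr := col_row_of_decays (M := M) hM
  have hZ := tsum_zeroth_eq_zero_of_col hS hδ hcov hlaw hcr.1 hcr.2 hδM hM1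
  have h13 := (anti13_iff_defect hS hδ hcov).2 ⟨hD0, hD1⟩
  have hQ : ∀ k μ ν, c * quadMomentOf M k μ ν =
      quadGerm (c * (-(1 / 2 : ℝ) * ∑' x : Site 4, M x 0 (Sum.inl 0) (Sum.inl 0) * ((x 1 : ℝ) * (x 1 : ℝ))))
        (c * ((-(1 / 2 : ℝ) * ∑' x : Site 4, M x 0 (Sum.inl 0) (Sum.inl 1) * ((x 0 : ℝ) * (x 1 : ℝ))) +
          (-(1 / 2 : ℝ) * ∑' x : Site 4, M x 0 (Sum.inl 0) (Sum.inl 1) * ((x 1 : ℝ) * (x 0 : ℝ))) +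
          (-(1 / 2 : ℝ) * ∑' x : Site 4, M x 0 (Sum.inl 0) (Sum.inl 0) * ((x 1 : ℝ) * (x 1 : ℝ)))))
        (c * ((-(1 / 2 : ℝ) * ∑' x : Site 4, M x 0 (Sum.inl 0) (Sum.inl 0) * ((x 0 : ℝ) * (x 0 : ℝ))) -
          (-(1 / 2 : ℝ) * ∑' x : Site 4, M x 0 (Sum.inl 0) (Sum.inl 0) * ((x 1 : ℝ) * (x 1 : ℝ))) -
          (-(1 / 2 : ℝ) * ∑' x : Site 4, M x 0 (Sum.inl 0) (Sum.inl 1) * ((x 0 : ℝ) * (x 1 : ℝ))) -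
          (-(1 / 2 : ℝ) * ∑' x : Site 4, M x 0 (Sum.inl 0) (Sum.inl 1) * ((x 1 : ℝ) * (x 0 : ℝ))))) k μ ν := by
    intro k μ ν
    rw [quadMomentOf_eq_quadGerm_bond hcr.1 hδM hM0 hM1 hP t hF k μ ν]
    unfold quadGerm
    ring
  exact cubicGermOf_eq_of_law_anti13 hS hδ hcov hlaw hcr.1 hcr.2 hδM hZ hQ h13

end Assembly

end Summit.QuantumFields.BalabanUV.Beta.FP.CubicGermExchange
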